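import Summits.NavierStokesRegularity.NavierStokesRegularity.Theorems.StrainDoorsNearFieldClosers
import Summits.NavierStokesRegularity.NavierStokesRegularity.Theorems.StrainClockBudgetedClosers
import Summits.NavierStokesRegularity.NavierStokesRegularity.Theorems.StrainClockDoorsClosers
import Literature.Analysis.FluidPDE.ConstantinDirectionDissipationCalculus
import Literature.Analysis.FluidPDE.LerayHopfConcatenation
import Literature.Analysis.FluidPDE.BKMClassGradientContinuity
import HarnessLib

/-!
# Near-field parity doors D7 / D7♭ — THE ENERGY-CLASS HALF PROVED (nsreg-p1 g33 ROUND-44; texts of record r43/Sketch47.lean v5 §7–§10)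

A2 `farFieldL1Bound_holds` (`|far_r| ≤ (2/r³)‖∇u(t)‖₂²`), A3′ `energyNonIncreasing_holds` (Tao 2013 L. 8.1 + 4.1(i): finite-energy
classical ⇒ Leray–Hopf — tree theorems `tao_pressure_normalisation_holds`, `tao2011_pressureTerm_estimate_holds`,
`tao_finite_energy_smooth_energy_bound_holds` by name), A3a `gradNormSqContinuousOn_holds` (Majda–Bertozzi Thm. 3.5 in the BKM
class: `IsClassicalNSSolutionOn.continuousOn_toReal_lintegral_frobeniusNormSq_fderiv_Ico`), A3⁺ `dissipationBudget_holds` (FTC +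
Tao's global energy bound), hence PLATE F `farFieldBudget_holds : FarFieldBudget` and
`nearFieldParityDoor_of_A1 : NewtonHessianFormula → NearFieldParityDoor`,
`nearFieldSubParityDoor_of_A1_A2 : NewtonHessianFormulaSmooth → FarFieldEnergyBound → NearFieldSubParityDoor`.
LANDING NOTE (ns-s29-p2 g5): the §7 A2 block (`continuous_frobeniusNormSq_fderiv_of_contDiff`,
`integrable_frobeniusNormSq_fderiv_of_frame`, `farFieldL1Bound_holds`, `farFieldBudget_of_dissipationPrimitive`,
`nearFieldParityDoor_of_A1_A3`) already LANDED byte-identically in `…Theorems.StrainDoorsNearFieldClosers` (p677841, from the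
v4 split) and is therefore OMITTED here and IMPORTED; everything else is r44/StrainDoorsNearFieldEnergy.lean 365cbdc177154727
verbatim (two one-line docstrings added for the gate's lint). HONEST FRAME: conditional doors; the remaining atoms A1/A1♭ (Calderón–Zygmund Hessian formulas of the Newtonian pressure)
and A2♭ are TRUE analysis facts still to be landed by the S-lane. -/

noncomputable section

open MeasureTheory Set Function Filter Metric Real InnerProductSpace
open _root_.Topology
open scoped ENNReal NNReal RealInnerProductSpace ContDiff Laplacian Interval
open Literature.Analysis Literature.Analysis.FluidPDE
open Literature.Analysis.FluidPDE.VorticityDirectionDynamics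

set_option linter.dupNamespace false

namespace Summit.NavierStokesRegularity.NavierStokesRegularity.Theorems.StrainDoors
/-! ## §7 ATOM A2 PROVED — `farFieldL1Bound_holds : FarFieldL1Bound` (kernel-checked; so plate F ← A3 alone) -/

/-- finite energy on every closed sub-slab `[0,T']`, `T' < T`, from the Sobolev frame (`n = 0`). -/
theorem finiteEnergy_of_frame {T T' : ℝ} {u : ℝ → (EuclideanSpace ℝ (Fin 3)) → (EuclideanSpace ℝ (Fin 3))}
    (hSob : ∀ T'' < T, HasBoundedSobolevNormsOn (Icc 0 T'') u) (hT'T : T' < T) :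
    ∃ A < (⊤ : ℝ≥0∞), ∀ t ∈ Icc 0 T', ∫⁻ x, ‖u t x‖ₑ ^ 2 ≤ A := by
  obtain ⟨C, hC⟩ := hSob T' hT'T 0
  refine ⟨C, ENNReal.coe_lt_top, fun t ht => ?_⟩
  refine (le_of_eq (lintegral_congr fun x => ?_)).trans (hC t ht)
  rw [← ofReal_norm, ← ofReal_norm, norm_iteratedFDeriv_zero]

/-- in the door frame the solution is Leray–Hopf from every `t₀ ∈ [0,T')`, `T' < T` (Tao 2013 Lemma 8.1 + 4.1(i), tree theorems by name). -/
theorem isLerayHopfOn_translate_of_frame {ν T T' t₀ : ℝ}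
    {u : ℝ → (EuclideanSpace ℝ (Fin 3)) → (EuclideanSpace ℝ (Fin 3))} {p : ℝ → (EuclideanSpace ℝ (Fin 3)) → ℝ}
    (hν : 0 < ν) (hsol : IsClassicalNSSolutionOn (Ico 0 T) ν 0 u p)
    (hSob : ∀ T'' < T, HasBoundedSobolevNormsOn (Icc 0 T'') u) (ht₀ : 0 ≤ t₀) (ht₀T' : t₀ < T') (hT'T : T' < T) :
    IsLerayHopfOn (T' - t₀) ν 0 (u t₀) (fun s => u (s + t₀)) ∧
      ContinuousInLpOn (Icc 0 (T' - t₀)) 2 (fun s => u (s + t₀)) := by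
  have hT'0 : 0 < T' := lt_of_le_of_lt ht₀ ht₀T'
  have hsolc : IsClassicalNSSolutionOn (Icc 0 T') ν 0 u p :=
    hsol.mono (Icc_subset_Ico_right hT'T) (uniqueDiffOn_Icc hT'0)
  exact hsolc.isLerayHopfOn_translate_of_finiteEnergy tao_pressure_normalisation_holds
    tao2011_pressureTerm_estimate_holds tao_finite_energy_smooth_energy_bound_holds hν ht₀ ht₀T'
    (finiteEnergy_of_frame hSob hT'T)

/-- ★ atom A3′ PROVED: the kinetic energy is non-increasing in the door frame. -/
theorem energyNonIncreasing_holds : EnergyNonIncreasing := by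
  intro ν T u p hν hsol hSob t₀ t ht₀ ht₀t htT
  set T' : ℝ := (t + T) / 2 with hT'
  have htT' : t < T' := by rw [hT']; linarith
  have hT'T : T' < T := by rw [hT']; linarith
  obtain ⟨hLH, -⟩ := isLerayHopfOn_translate_of_frame hν hsol hSob ht₀ (lt_of_le_of_lt ht₀t htT') hT'T
  have h := hLH.kineticEnergy_le_of_zero_force hν.le (t := t - t₀) ⟨by linarith, by linarith⟩
  simpa using h

/-- plate F♭ from A2♭ alone (A3′ proved). -/
theorem farFieldUniformBound_of_energyBound (h2 : FarFieldEnergyBound) : FarFieldUniformBound :=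
  farFieldUniformBound_of h2 energyNonIncreasing_holds

/-- ★ D7♭ from A1♭ and A2♭ only. -/
theorem nearFieldSubParityDoor_of_A1_A2 (h1 : NewtonHessianFormulaSmooth) (h2 : FarFieldEnergyBound) :
    NearFieldSubParityDoor :=
  nearFieldSubParityDoor_of_atoms h1 h2 energyNonIncreasing_holds

/-- A3 ⇒ A3⁺: a dissipation primitive with the explicit budget `E(t₀)/ν` is one with some budget. -/
theorem dissipationBudget_of_primitive (h3 : DissipationPrimitive) : DissipationBudget := by
  intro ν T t₀ u p hν ht₀ hT hsol hSob
  obtain ⟨Φ, hΦ0, hΦ⟩ := h3 ν T t₀ u p hν ht₀ hT hsol hSob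
  exact ⟨VectorCalculus.kineticEnergy (u t₀) / ν, Φ, hΦ0, hΦ⟩

/-- F ← A2 ∧ A3⁺ (same bookkeeping as `farFieldBudget_of`). -/
theorem farFieldBudget_of' (h2 : FarFieldL1Bound) (h3 : DissipationBudget) : FarFieldBudget := by
  intro ν T t₀ r u p hν ht₀ hT hr hsol hSob
  obtain ⟨β, Φ, hΦ0, hΦ⟩ := h3 ν T t₀ u p hν ht₀ hT hsol hSob
  have h2π : 0 < 2 * π * r ^ 3 := by positivity
  refine ⟨β / (2 * π * r ^ 3), fun t => Φ t / (2 * π * r ^ 3),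
    fun t => VectorCalculus.gradNormSq (u t) / (2 * π * r ^ 3), by simp [hΦ0], ?_, ?_⟩
  · intro t ht
    obtain ⟨h0, hE, hd⟩ := hΦ t ht
    exact ⟨div_nonneg h0 h2π.le, div_le_div_of_nonneg_right hE h2π.le, hd.div_const _⟩
  · intro t ht x e he
    have ht' : t ∈ Ico 0 T := ⟨ht₀.trans ht.1, ht.2⟩
    have hb := h2 ν T u p hν hsol hSob t ht' r hr x e he
    have hpi : 0 < 1 / (4 * π) := by positivity
    calc 1 / (4 * π) * |farQuad r u t x e| ≤ 1 / (4 * π) * (2 / r ^ 3 * VectorCalculus.gradNormSq (u t)) :=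
          mul_le_mul_of_nonneg_left hb hpi.le
      _ = VectorCalculus.gradNormSq (u t) / (2 * π * r ^ 3) := by
          field_simp
          ring

/-- `0 ≤ ‖∇v‖₂²`. -/
theorem gradNormSq_nonneg' (v : (EuclideanSpace ℝ (Fin 3)) → (EuclideanSpace ℝ (Fin 3))) :
    0 ≤ VectorCalculus.gradNormSq v :=
  integral_nonneg fun _ => frobeniusNormSq_nonneg _

/-- `ofReal ‖∇u(t)‖₂² = ∫⁻ ofReal |∇u(t,x)|²_F` in the frame. -/
theorem ofReal_gradNormSq_eq_lintegral {ν T : ℝ}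
    {u : ℝ → (EuclideanSpace ℝ (Fin 3)) → (EuclideanSpace ℝ (Fin 3))} {p : ℝ → (EuclideanSpace ℝ (Fin 3)) → ℝ}
    (hsol : IsClassicalNSSolutionOn (Ico 0 T) ν 0 u p) (hSob : ∀ T'' < T, HasBoundedSobolevNormsOn (Icc 0 T'') u)
    {t : ℝ} (ht : t ∈ Ico 0 T) :
    ENNReal.ofReal (VectorCalculus.gradNormSq (u t)) = ∫⁻ x, ENNReal.ofReal (frobeniusNormSq (fderiv ℝ (u t) x)) :=
  ofReal_integral_eq_lintegral_ofReal (integrable_frobeniusNormSq_fderiv_of_frame hsol hSob ht)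
    (ae_of_all _ fun _ => frobeniusNormSq_nonneg _)

/-- ★ A3a ⇒ A3⁺: the primitive `Φ(t) = ∫_{t₀}^{t} ‖∇u‖₂²` is differentiable with the right derivative (FTC, continuity of the
integrand) and bounded by Tao's global energy bound `ν ∫₀^{T'}‖∇u‖₂² ≤ C‖u(0)‖₂²` on every `[0,T']`, `T' < T` (uniform in `T'`). -/
theorem dissipationBudget_of_continuousOn (hA : GradNormSqContinuousOn) : DissipationBudget := by
  intro ν T t₀ u p hν ht₀ ht₀T hsol hSob
  obtain ⟨C, hCtop, hC⟩ := tao_finite_energy_smooth_energy_bound_holds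
  set g : ℝ → ℝ := fun τ => VectorCalculus.gradNormSq (u τ) with hg_def
  have hg : ContinuousOn g (Ico 0 T) := hA ν T u p hν hsol hSob
  -- the integrand frozen to the left of `t₀` (so that the primitive is differentiable AT `t₀` too)
  set gh : ℝ → ℝ := fun τ => g (max τ t₀) with hgh_def
  have hmaps : MapsTo (fun τ : ℝ => max τ t₀) (Iio T) (Ico 0 T) :=
    fun τ hτ => ⟨ht₀.trans (le_max_right _ _), max_lt hτ ht₀T⟩
  have hghc : ContinuousOn gh (Iio T) := hg.comp (continuous_id.max continuous_const).continuousOn hmaps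
  -- the energy budget: `β = (C ∫|u(0)|² / ν).toReal`
  have h0T : (0 : ℝ) ∈ Ico 0 T := ⟨le_rfl, ht₀.trans_lt ht₀T⟩
  obtain ⟨A₀, hA₀top, hA₀⟩ := finiteEnergy_of_frame hSob (show (t₀ + T) / 2 < T by linarith)
  have hE0 : ∫⁻ x, ‖u 0 x‖ₑ ^ 2 ≤ A₀ := hA₀ 0 ⟨le_rfl, by linarith⟩
  have hν' : ENNReal.ofReal ν ≠ 0 := (ENNReal.ofReal_pos.2 hν).ne'
  set Bud : ℝ≥0∞ := C * (∫⁻ x, ‖u 0 x‖ₑ ^ 2) / ENNReal.ofReal ν with hBud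
  have hBud_top : Bud < ⊤ := by
    refine ENNReal.div_lt_top (ENNReal.mul_ne_top hCtop.ne (hE0.trans_lt hA₀top).ne) hν'
  refine ⟨Bud.toReal, fun t => ∫ τ in t₀..t, gh τ, by simp, ?_⟩
  intro t ht
  have htT : t < T := ht.2
  -- FTC
  have hii : IntervalIntegrable gh volume t₀ t :=
    (hghc.mono (by rw [uIcc_of_le ht.1]; exact fun τ hτ => lt_of_le_of_lt hτ.2 htT)).intervalIntegrable
  have hderiv : HasDerivAt (fun s => ∫ τ in t₀..s, gh τ) (gh t) t :=
    intervalIntegral.integral_hasDerivAt_right hii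
      (hghc.stronglyMeasurableAtFilter isOpen_Iio t htT) (hghc.continuousAt (Iio_mem_nhds htT))
  have hgh_t : gh t = g t := by simp [hgh_def, max_eq_left ht.1]
  rw [hgh_t] at hderiv
  -- nonnegativity
  have hnn : 0 ≤ ∫ τ in t₀..t, gh τ :=
    intervalIntegral.integral_nonneg ht.1 fun τ _ => gradNormSq_nonneg' _
  refine ⟨hnn, ?_, hderiv⟩
  -- the bound, on the sub-slab `[0,T']`, `T' = (t+T)/2`
  set T' : ℝ := (t + T) / 2 with hT'
  have htT' : t < T' := by rw [hT']; linarith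
  have hT'T : T' < T := by rw [hT']; linarith
  have hT'0 : 0 < T' := lt_of_le_of_lt (ht₀.trans ht.1) htT'
  have hsolc : IsClassicalNSSolutionOn (Icc 0 T') ν 0 u p :=
    hsol.mono (Icc_subset_Ico_right hT'T) (uniqueDiffOn_Icc hT'0)
  obtain ⟨-, hD⟩ := hC ν T' hν hT'0 u p hsolc (finiteEnergy_of_frame hSob hT'T)
  have hD' : ∫⁻ τ in Ioo 0 T', ∫⁻ x, ENNReal.ofReal (frobeniusNormSq (fderiv ℝ (u τ) x)) ≤ Bud := by
    rw [hBud, ENNReal.le_div_iff_mul_le (Or.inl hν') (Or.inl ENNReal.ofReal_ne_top), mul_comm]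
    exact hD
  -- `Φ t` as a lintegral
  have hIcc : Icc t₀ t ⊆ Ico 0 T := fun τ hτ => ⟨ht₀.trans hτ.1, lt_of_le_of_lt hτ.2 htT⟩
  have hgi : IntegrableOn g (Ioc t₀ t) volume :=
    ((hg.mono hIcc).integrableOn_compact isCompact_Icc).mono_set Ioc_subset_Icc_self
  have hΦeq : (∫ τ in t₀..t, gh τ) = ∫ τ in Ioc t₀ t, g τ := by
    rw [intervalIntegral.integral_of_le ht.1]
    exact setIntegral_congr_fun measurableSet_Ioc fun τ hτ => by simp [hgh_def, max_eq_left hτ.1.le]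
  have hof : ENNReal.ofReal (∫ τ in Ioc t₀ t, g τ) ≤ Bud := by
    rw [ofReal_integral_eq_lintegral_ofReal hgi (ae_of_all _ fun τ => gradNormSq_nonneg' _)]
    calc ∫⁻ τ in Ioc t₀ t, ENNReal.ofReal (g τ)
        = ∫⁻ τ in Ioc t₀ t, ∫⁻ x, ENNReal.ofReal (frobeniusNormSq (fderiv ℝ (u τ) x)) :=
          setLIntegral_congr_fun measurableSet_Ioc fun τ hτ =>
            ofReal_gradNormSq_eq_lintegral hsol hSob ⟨ht₀.trans hτ.1.le, lt_of_le_of_lt hτ.2 htT⟩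
      _ ≤ ∫⁻ τ in Ioo 0 T', ∫⁻ x, ENNReal.ofReal (frobeniusNormSq (fderiv ℝ (u τ) x)) :=
          lintegral_mono_set fun τ hτ => ⟨lt_of_le_of_lt ht₀ hτ.1, lt_of_le_of_lt hτ.2 htT'⟩
      _ ≤ Bud := hD'
  show (∫ τ in t₀..t, gh τ) ≤ Bud.toReal
  rw [hΦeq]
  have := ENNReal.toReal_mono hBud_top.ne hof
  rwa [ENNReal.toReal_ofReal (by rw [← hΦeq]; exact hnn)] at this

/-- ★ D7 from A1 (the Calderón–Zygmund Hessian formula) and A3a (continuity of `t ↦ ‖∇u(t)‖₂²`) ONLY — every energy-class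
input (A2 far-field bound, Tao's Lemma 8.1 energy bound, the FTC budget) is now kernel-checked. -/
theorem nearFieldParityDoor_of_A1_A3a (h1 : NewtonHessianFormula) (hA : GradNormSqContinuousOn) : NearFieldParityDoor :=
  nearFieldParityDoor_of_plates (pressureHessianSplits_of h1)
    (farFieldBudget_of' farFieldL1Bound_holds (dissipationBudget_of_continuousOn hA))

/-! ## §10 ATOM A3a PROVED ⇒ PLATE F PROVED ⇒ D7 ← A1 ALONE
(`IsClassicalNSSolutionOn.continuousOn_toReal_lintegral_frobeniusNormSq_fderiv_Ico`, Majda–Bertozzi Thm. 3.5 in the BKM/Sobolev class — a tree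
theorem in exactly the door frame, file `Literature/Analysis/FluidPDE/BKMClassGradientContinuity.lean`). -/

/-- ★ atom A3a PROVED: `t ↦ ‖∇u(t)‖₂²` is continuous on `[0,T)` in the door frame. -/
theorem gradNormSqContinuousOn_holds : GradNormSqContinuousOn := by
  intro ν T u p hν hsol hSob
  refine (hsol.continuousOn_toReal_lintegral_frobeniusNormSq_fderiv_Ico hSob).congr fun t ht => ?_
  show VectorCalculus.gradNormSq (u t) = (∫⁻ x, ENNReal.ofReal (frobeniusNormSq (fderiv ℝ (u t) x))).toReal
  rw [← ofReal_gradNormSq_eq_lintegral hsol hSob ht, ENNReal.toReal_ofReal (gradNormSq_nonneg' _)]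

/-- ★ atom A3⁺ PROVED (the dissipation budget `Φ = ∫_{t₀}^{t}‖∇u‖₂²`, `0 ≤ Φ ≤ C‖u(0)‖₂²/ν`, `Φ' = ‖∇u(t)‖₂²` on `[t₀,T)`). -/
theorem dissipationBudget_holds : DissipationBudget :=
  dissipationBudget_of_continuousOn gradNormSqContinuousOn_holds

/-- ★★ PLATE F PROVED: the far-field budget of door D7 is a theorem of the frame. -/
theorem farFieldBudget_holds : FarFieldBudget :=
  farFieldBudget_of' farFieldL1Bound_holds dissipationBudget_holds

/-- ★★ D7 «NearFieldParityDoor» from the single remaining atom A1 «NewtonHessianFormula» (the Calderón–Zygmund second-derivative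
formula of the Newtonian pressure with the near/far split at radius `r`): `NewtonHessianFormula → NearFieldParityDoor`. -/
theorem nearFieldParityDoor_of_A1 (h1 : NewtonHessianFormula) : NearFieldParityDoor :=
  nearFieldParityDoor_of_plates (pressureHessianSplits_of h1) farFieldBudget_holds

end Summit.NavierStokesRegularity.NavierStokesRegularity.Theorems.StrainDoors

end
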